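import Summits.BirchSwinnertonDyer.BirchSwinnertonDyer.Theorems.ErratumRoadFiveIMCDivRoadFFFittingCutBFeed
import Summits.BirchSwinnertonDyer.BirchSwinnertonDyer.Theorems.ErratumRoadFiveIMCDivRoadFFSigmaDataBNoDefect
import Summits.BirchSwinnertonDyer.BirchSwinnertonDyer.Theorems.ErratumRoadFiveIMCDivMemberCongruenceErratumTame
import Summits.BirchSwinnertonDyer.BirchSwinnertonDyer.Theorems.ErratumRoadFiveOpenInputIMCFromErratumFact
import Summits.BirchSwinnertonDyer.Rank1Residual.X11b.AnticyclotomicLocalTorsionDescent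
import Summits.BirchSwinnertonDyer.Rank1Residual.X11b.EmbeddingDatumPrime
import Literature.NumberTheory.EllipticCurves.Castella2018.ErratumHidaMembersCongruence
import Literature.NumberTheory.EllipticCurves.Castella2018.SigmaSelmerUnramifiedOutsideSProofs
import Literature.NumberTheory.EllipticCurves.SkinnerUrban2014.CofinitelyGeneratedSelmer
import Literature.NumberTheory.EllipticCurves.CofreeTorsionFiniteness
import Literature.NumberTheory.EllipticCurves.OrdinaryNewformDatumCofreeUnramified
import HarnessLib

/-!
# K2 crux `IMCDivAtErratumDataAllR` (item stmt-BirchSwinnertonDyer-20169; H3♭ re-oriented), ROAD FF v4-B′ —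
# the DECIDING stub `stub_roadFF_fittingCongruenceFrameB` PROVED MODULO NAMED FACTS

Cell `bsd-stepL` (run/shared/lean/pub/bsd-stepL/), seat `bsd-stepL-imc-p1` (prover g10, 2026-08-27);
`--supports stmt-BirchSwinnertonDyer-20169 --as helper`; Theses-free (the registered stub signature
`∀ W p, P2.RoadFF.FittingCongruenceFrameAtErratumDataB W p Σ(·) P_Σ(·)` of
`Cruxes/IMCDivAtErratumDataAllR/Lines/birth.lean` is concluded VERBATIM, from named facts only).

## What this file proves

Companion `Theorems/ErratumRoadFiveIMCDivMemberCongruenceErratumTame.lean` (same seat): the receptacle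
`(R₀ ⊗_{ℤ_p} 𝒪_m)⟦T⟧` and the member congruence `e_m` at the erratum data with the CORRECT `Σ`-hypothesis.

* **`P2.RoadFF.fittingCongruenceFrameAtErratumDataB_of_facts`** — THE DECIDING STUB from THREE named facts:
  (OPEN, claim-tagged, UNREFEREED) `Castella2018.erratum_members_exists_isTorsion_charIdeal_le_congruence_OPEN`
  (T3, p506536: frame of `f` [Cas18 3.1] + Hida members with (b), Thm. 2.3 torsion, (2.5)_m via [FW21 4.41], (c));
  (PUB) `SkinnerUrban2014.prop323_XAc_equiv_XBigDecomp` (Shapiro, [SU14] Prop. 3.2.3) and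
  `SkinnerUrban2014.lemma319_finite_XBig` ([SU14] Lemma 3.1.9, `ℤ_p` form). The other inputs are THEOREMS of the
  tree: (SelBC) `Skinner2016.selmerBig_extendScalars_equiv_baseChange_holds` (defn-ty1 p512382), the `Σ`-bridge
  `Castella2018.selmerBig_eq_selmerBigDecomp_of_unramifiedOutside_holds` (bsd-cited r17 p515125), finite generation of
  `X^Σ_ac(A_{g_m})` over `Λ_{𝒪_m}` from the `ℤ_p` fact (`SkinnerUrban2014.moduleFinite_XBig_of_lemma319`, p513272,
  with `Cofree.exists_pow_psmul_eq_zero` ∕ `Cofree.finite_setOf_psmul_eq_zero` p515080 and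
  `OrdinaryNewformDatum.cofreeRepOver_localMap_inr_apply_eq_self` p515972), (Frob) ∕ PID ∕ finite free (T1 p503222),
  faithful flatness (T4 p507140). Assembly through p495387's
  `P2.RoadFF.fittingCongruenceFrameTwoSlotAt_of_members_descent_le_printed` with `R'_m = 𝒪_m⟦T⟧` (Noetherian UFD:
  `𝒪_m` a PID, Mathlib), `N_m = XBig κ (A_{g_m}|_{Γ_K}) 𝔭bar Σ`, `S'_m = (R₀ ⊗_{ℤ_p} 𝒪_m)⟦T⟧`,
  `φ'_m = map includeRight`, `L^Σ = L·P_Σ`, `Σ = W.sigmaPlacesFinset p K`. The member fact's binders are discharged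
  from the erratum datum exactly as in `imcEqCoreFrameOnTree_of_erratumThm11_OPEN`; its level hypothesis `3 ≤ N/p`
  (flag Mem-M-ge-3) HOLDS at every erratum datum of the registered stub: `Cas20Standing` makes `d_K` odd,
  `IsErratumField` gives `q ∣ d_K`, so `q` is odd and `N/p ≥ q ≥ 3`.

HONEST FRAMING: theorems only (no definition, no named fact minted here, no instance, no `sorry`); CONDITIONAL on the
three named facts, one of which (the member package, resting on the unrefereed erratum and arXiv:2107.13726 Thm. 4.41)
is OPEN; nothing is booked; the anticyclotomic main conjecture is asserted nowhere; BSD is proved for no pair; no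
census number moves (T7). With this file the v4-B′ skeleton's deciding stub closes INSIDE from by-name fact stubs
(planner's re-registration), i.e. crux 20169 becomes dischargeable-by-citation modulo the OPEN member package.

References: [Castella2018Erratum] Thm. 1.1, §2, Thm. 2.3, (2.3)–(2.5), (b), (c), Lemma 2.1, proof of Thm. 1.1
(pp. 1–4); [FouquetWan2021] Thm. 4.41 (PREPRINT); [Skinner2016PacificMC] §2.3 (p. 179), §2.6 (2-6-1), §3.1 (p. 192);
[SkinnerUrban2014] Prop. 3.2.3, Lemma 3.1.9 (p. 20); [Castella2020JIMJ] §2.5, Thm. 2.11; [Castella2018] Def. 2.2,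
Thm. 3.1, (3.1) (arXiv:1704.06608 pp. 5, 9); [Benhissi2022] Ch. 1 §9 Prop. 9.4 (3); [SerreLocalFields1979] III §3;
HOME/imc-p1/g9/EM-KERNEL-COMPLETE-20169-imc-p1-g9.md; STATUS defn-ty1 2026-08-27T06:33–06:59Z.
-/

set_option autoImplicit false

noncomputable section

open scoped TensorProduct Classical

open CategoryTheory PowerSeries NumberField IsDedekindDomain Field WeierstrassCurve
open Literature.NumberTheory.GaloisRepresentations Literature.NumberTheory.EllipticCurves
  Literature.NumberTheory.EllipticCurves.BigGaloisRep Literature.NumberTheory.EllipticCurves.GreenbergSelmer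
  Literature.NumberTheory.EllipticCurves.Skinner2016 Literature.NumberTheory.EllipticCurves.Rank1Residual
  Literature.NumberTheory.EllipticCurves.Rank1Residual.Typed Literature.NumberTheory.EllipticCurves.ModularForms
  Literature.NumberTheory.EllipticCurves.Castella2018
open Summit.BirchSwinnertonDyer.Rank1Residual.X11b.Halves Summit.BirchSwinnertonDyer.Rank1Residual.X11b.AcSelmer

/-! ### The deciding stub of skeleton v4-B′ from the named facts -/

namespace Summit.BirchSwinnertonDyer.Rank1Residual.X11b

open RoadFFMember Summit.BirchSwinnertonDyer.BirchSwinnertonDyer.Theorems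

-- The closing `exact` unifies five `ℕ`-indexed families of coefficient rings / modules / maps with the feeder's
-- binders; it needs ≈ 2× the default heartbeat budget (measured: fails at 200 000, passes at 400 000).
set_option maxHeartbeats 400000 in
/-- **ROAD FF, DECIDING STUB `stub_roadFF_fittingCongruenceFrameB` OF CRUX `IMCDivAtErratumDataAllR` (item
stmt-BirchSwinnertonDyer-20169), MODULO NAMED FACTS.** For every globally minimal elliptic `W/ℚ` and prime `p`, at
every erratum datum and every X-slot `𝔭bar ≠ 𝔭_{ι'}`: the two-slot Fitting-level congruence frame
`P2.RoadFF.FittingCongruenceFrameTwoSlotAt W p κ 𝔭_{ι'} 𝔭bar γ ι' f_E Σ(K) P_Σ(K, κ)` — i.e. EXACTLY the registered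
signature `∀ W p, P2.RoadFF.FittingCongruenceFrameAtErratumDataB W p Σ(·) P_Σ(·)` — from
* (OPEN, claim-tagged; UNREFEREED) the erratum's member package
  `Castella2018.erratum_members_exists_isTorsion_charIdeal_le_congruence_OPEN` (frame of `f` at `(ι', 𝔭_{ι'})`
  [Cas18 Thm. 3.1], Hida members `g_m` with (b), Thm. 2.3 torsion and (2.5)_m via [FW21, Thm. 4.41], (c) [Cas20 2.11]);
* (PUB) `SkinnerUrban2014.prop323_XAc_equiv_XBigDecomp` (Shapiro) and `SkinnerUrban2014.lemma319_finite_XBig`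
  (finite generation of dual Selmer groups, [SU14] Lemma 3.1.9);
every other input being a THEOREM of the tree ((SelBC) `…_holds` p512382, the `Σ`-bridge `…_holds` p515125,
`moduleFinite_XBig_of_lemma319` p513272, (T1), (T4), (T7), (T8a)).
Assembly: the binders of the member package are discharged from the erratum datum (`5 ≤ p`; `Mult W p`; `Irr`; the
Heegner datum's `β`; `p` split and every `ℓ ∣ N`, `ℓ ≠ q` split on an erratum field; `q ∣ d_K` nonsplit; (ii) from the
field's `2`-clause; (iv) from the A′-locus; `3 ≤ N/p` since `q` is ODD (`d_K` odd by `Cas20Standing`, `q ∣ d_K`) and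
`pq ∣ N`); per `m ≥ 1` the member `D_m` (level `max m 1`), its coefficient ring `𝒪_m` (PID, finite free over `ℤ_p`:
defn-ty1 (T1)), the receptacle `S'_m = (R₀ ⊗_{ℤ_p} 𝒪_m)⟦T⟧` (faithfully flat over `R₀⟦T⟧`: (T4)), the congruence
`e_m` (`nonempty_memberCongruence_erratum_tame`: (F1) + (SelBC) + (Frob) + (b) + Lemma 2.1), `Ch·S' ⊆ (L_m)` and
`(L_m) ⊆ (L·P_Σ) + (p^m)` read in `S'_m` (`a = algebraMap`, `b = includeRight`, `j = toUnr`), fed to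
`P2.RoadFF.fittingCongruenceFrameTwoSlotAt_of_members_descent_le_printed` (p495387). CONDITIONAL on the three named
facts (one of them OPEN and unrefereed); nothing is booked; BSD is proved for no pair; no census number moves (T7).
[claim: Castella2018Erratum, status: under-review] [claim: FouquetWan2021, status: under-review]
[cite: Castella2018Erratum, Thm. 1.1, Thm. 2.3, (2.3)–(2.5), (b), (c), Lemma 2.1 and proof of Thm. 1.1 (pp. 1–4)]
[cite: Skinner2016PacificMC, §2.3 (p. 179), §2.6 (2-6-1), §3.1 (a)(b) (p. 192)] [cite: SkinnerUrban2014, Prop. 3.2.3, Lemma 3.1.9]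
[cite: Castella2020JIMJ, §2.5, Thm. 2.11] [cite: Castella2018, Thm. 3.1, (3.1) (arXiv:1704.06608 p. 9)] -/
theorem P2.RoadFF.fittingCongruenceFrameAtErratumDataB_of_facts
    (hMem : erratum_members_exists_isTorsion_charIdeal_le_congruence_OPEN)
    (hSh : SkinnerUrban2014.prop323_XAc_equiv_XBigDecomp) (hFG : SkinnerUrban2014.lemma319_finite_XBig)
    (W : WeierstrassCurve ℚ) [W.IsElliptic] [W.IsGloballyMinimal] (p : ℕ) [Fact p.Prime] :
    P2.RoadFF.FittingCongruenceFrameAtErratumDataB W p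
      (fun K _ _ ↦ (↑(W.sigmaPlacesFinset p K) : Set (HeightOneSpectrum (𝓞 K))))
      (fun K _ _ κ _ ↦ W.sigmaEulerElement p K κ) := by
  intro _ q _ K _ _ Dt H w₀ P hE hr hqp hmq hns hvq hK hCas hP hc hinf κ hκ γ _ ι' e he 𝔭bar h𝔭bar hne
  show P2.RoadFF.FittingCongruenceFrameTwoSlotAt W p κ (primeOfEmbeddingDatum p ι' w₀.embedding) 𝔭bar γ ι'
    Dt.f (↑(W.sigmaPlacesFinset p K) : Set (HeightOneSpectrum (𝓞 K))) (W.sigmaEulerElement p K κ)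
  -- ### the datum's elementary consequences
  have hp5 : 5 ≤ p := hE.1
  have hp3 : 3 < p := lt_of_lt_of_le (by norm_num) hp5
  have hmult : Mult W p := hE.2.1
  have hirr : Irr W p := hE.2.2.1
  have htors : ∀ Q : (W.baseChange ℚ_[p]).toAffine.Point, p • Q = 0 → Q = 0 := hE.2.2.2.2
  have hpN : p ∣ W.conductorNorm ℤ := dvd_conductorNorm_of_mult hmult
  have hsplit2 : ((Ideal.span {(p : ℤ)}).primesOver (𝓞 K)).ncard = 2 :=
    hK.ncard_primesOver_eq_two Fact.out hpN hqp
  have hsp : SplitsIn K p := hK.splitsIn_of_mult hmult (Ne.symm hqp)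
  have hHp : SatisfiesHeegnerHypothesis p K := satisfiesHeegnerHypothesis_of_splitsIn Fact.out hsp
  have hHeeg : ∃ β : ℤ, (4 * (W.conductorNorm ℤ) : ℤ) ∣ β ^ 2 - NumberField.discr K :=
    ⟨H.β, H.dvd_sq_sub⟩
  have hnq : ((Ideal.span {(q : ℤ)}).primesOver (𝓞 K)).ncard ≠ 2 :=
    ncard_primesOver_ne_two_of_dvd_discr hK.1.1 Fact.out hK.2.1
  -- every multiplicative prime nonsplit in `K` is `q`
  have key : ∀ (ℓ : ℕ) [Fact ℓ.Prime], Mult W ℓ →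
      ((Ideal.span {(ℓ : ℤ)}).primesOver (𝓞 K)).ncard ≠ 2 → ℓ = q := by
    intro ℓ _ hℓ hnsℓ
    by_contra hne'
    exact hnsℓ (hK.2.2.1 ℓ Fact.out (dvd_conductorNorm_of_mult hℓ) hne')
  -- (ii) if `2` is nonsplit then `2 ∥ N`
  have h2 : ((Ideal.span {(2 : ℤ)}).primesOver (𝓞 K)).ncard ≠ 2 → Mult W 2 := by
    intro h2ns
    by_cases h2N : 2 ∣ W.conductorNorm ℤ
    · by_cases h2q : (2 : ℕ) = q
      · haveI : Fact (Nat.Prime 2) := ⟨Nat.prime_two⟩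
        subst h2q
        exact hmq
      · exact absurd (hK.2.2.1 2 Nat.prime_two h2N h2q) h2ns
    · exact absurd (hK.2.2.2.1 h2N) h2ns
  -- (iii) nonsplit multiplicative at the nonsplit multiplicative primes (= `q`), `E[p]` ramified at `q`
  have hns' : ∀ (ℓ : ℕ) [Fact ℓ.Prime], Mult W ℓ →
      ((Ideal.span {(ℓ : ℤ)}).primesOver (𝓞 K)).ncard ≠ 2 →
        ¬ W.HasSplitMultiplicativeReductionAtPrime ℓ := by
    intro ℓ _ hℓ hnsℓ
    obtain rfl := key ℓ hℓ hnsℓ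
    exact hns
  have hram' : ∃ (ℓ : ℕ) (_ : Fact ℓ.Prime), Mult W ℓ ∧
      ((Ideal.span {(ℓ : ℤ)}).primesOver (𝓞 K)).ncard ≠ 2 ∧
        ¬ p ∣ padicValInt ℓ W.minimalDiscriminantInt :=
    ⟨q, ‹_›, hmq, hnq, hvq⟩
  -- `3 ≤ M = N/p` (Thm. 2.3's level hypothesis): `q` is odd (`d_K` odd, `q ∣ d_K`) and `q ∣ N/p`
  have hMpos : 0 < W.conductorNorm ℤ / p := hCas.2.2.2.2.2.1
  have hpM : ¬ p ∣ W.conductorNorm ℤ / p := hCas.2.2.2.2.2.2.1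
  have hq2 : q ≠ 2 := by
    rintro rfl
    have hodd : Odd (NumberField.discr K) := hCas.2.1
    have h2d : (2 : ℤ) ∣ NumberField.discr K := by exact_mod_cast hK.2.1
    exact (Int.not_even_iff_odd.mpr hodd) (even_iff_two_dvd.mpr h2d)
  have hM : 3 ≤ W.conductorNorm ℤ / p := by
    have hqprime : q.Prime := Fact.out
    have hqN : q ∣ W.conductorNorm ℤ := dvd_conductorNorm_of_mult hmq
    have hqM : q ∣ W.conductorNorm ℤ / p := by
      rw [← Nat.div_mul_cancel hpN] at hqN
      exact ((Nat.Coprime.dvd_mul_right ((Nat.coprime_primes hqprime Fact.out).2 hqp)).1 hqN)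
    have hq3 : 3 ≤ q := by
      rcases hqprime.eq_two_or_odd' with h | h
      · exact absurd h hq2
      · have := hqprime.two_le; omega
    exact hq3.trans (Nat.le_of_dvd hMpos hqM)
  haveI : NeZero (W.conductorNorm ℤ / p) := ⟨hMpos.ne'⟩
  -- ### `Σ`
  have hSfin : (↑(W.sigmaPlacesFinset p K) : Set (HeightOneSpectrum (𝓞 K))).Finite :=
    (W.sigmaPlacesFinset p K).finite_toSet
  have hSp : ∀ w ∈ (↑(W.sigmaPlacesFinset p K) : Set (HeightOneSpectrum (𝓞 K))),
      ((p : ℕ) : 𝓞 K) ∉ w.asIdeal :=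
    fun w hw => W.forall_mem_sigmaPlacesFinset_not_mem p K w (Finset.mem_coe.1 hw)
  have hS : ∀ w : HeightOneSpectrum (𝓞 K), w ∉ (↑(W.sigmaPlacesFinset p K) : Set (HeightOneSpectrum (𝓞 K))) →
      ((p : ℕ) : 𝓞 K) ∉ w.asIdeal → (W.baseChange K).HasGoodReductionAt w := by
    intro w hw hwp
    rw [WeierstrassCurve.coe_sigmaPlacesFinset] at hw
    exact WeierstrassCurve.hasGoodReductionAt_baseChange_of_not_mem_sigmaPlaces hw hwp
  have hSM : ∀ w : HeightOneSpectrum (𝓞 K), w ∉ (↑(W.sigmaPlacesFinset p K) : Set (HeightOneSpectrum (𝓞 K))) →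
      ((W.conductorNorm ℤ / p : ℕ) : 𝓞 K) ∉ w.asIdeal := by
    intro w hw hM'
    rw [WeierstrassCurve.coe_sigmaPlacesFinset] at hw
    exact hw (WeierstrassCurve.mem_sigmaPlaces_of_tameLevel_mem hpN hpM hM')
  -- ### `K_{𝔭bar} → ℚ_p` (degree one)
  obtain ⟨heb, hfb⟩ := degreeOne_of_splitsIn hK.1.1 hsp h𝔭bar
  obtain ⟨φ⟩ := AcSelmer.exists_ringHom_adicCompletion_padic_of_degreeOne p 𝔭bar h𝔭bar heb hfb
  -- ### the member package (T3)
  obtain ⟨ΩK, Ωp, L, hΩ, hL, hmem⟩ :=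
    exists_frame_members_charIdeal_le_congruence_le_of_OPEN ι' W K (primeOfEmbeddingDatum p ι' w₀.embedding)
      𝔭bar κ γ Dt.isNewformOf rfl hp3 hmult hM hK.1 hHeeg hsplit2
      (natCast_mem_primeOfEmbeddingDatum p ι' w₀.embedding) (forall_mem_primeOfEmbeddingDatum_iff p ι' hK.1 w₀)
      h𝔭bar hne hirr h2 hns' hram' htors hκ hMem
  -- a member at every level `max m 1`
  choose Dm hDm using fun m : ℕ => hmem (max m 1) (le_max_right m 1)
  -- ### topologies (the statements are topology-free; take discrete ones) and coefficient-ring instances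
  letI : TopologicalSpace (IwasawaAlgebra p) := ⊥
  haveI : DiscreteTopology (IwasawaAlgebra p) := ⟨rfl⟩
  letI τ : ∀ m : ℕ, TopologicalSpace (PowerSeries (padicCoeffIntegers (Dm m).ι)) := fun _ => ⊥
  haveI : ∀ m : ℕ, DiscreteTopology (PowerSeries (padicCoeffIntegers (Dm m).ι)) := fun _ => ⟨rfl⟩
  haveI : ∀ m : ℕ, IsPrincipalIdealRing (padicCoeffIntegers (Dm m).ι) := fun m =>
    (Dm m).isPrincipalIdealRing_coeffRing
  haveI : ∀ m : ℕ, Module.Free ℤ_[p] (padicCoeffIntegers (Dm m).ι) := fun m => (Dm m).moduleFree_coeffRing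
  haveI : ∀ m : ℕ, Module.Finite ℤ_[p] (padicCoeffIntegers (Dm m).ι) := fun m =>
    (Dm m).moduleFinite_coeffRing
  letI : Algebra ℤ_[p] (unrIntegers p) := (toUnr p).toAlgebra
  have hj : algebraMap ℤ_[p] (unrIntegers p) = toUnr p := rfl
  haveI : ∀ m : ℕ, Module.FaithfullyFlat (UnrSeries p)
      (PowerSeries (unrIntegers p ⊗[ℤ_[p]] padicCoeffIntegers (Dm m).ι)) := fun m =>
    faithfullyFlat_receptacle p (padicCoeffIntegers (Dm m).ι)
  -- torsion and the receptacle clause of every member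
  have hT : ∀ m : ℕ, Module.IsTorsion (PowerSeries (padicCoeffIntegers (Dm m).ι))
      (XBig κ ((Dm m).Δ.cofreeRepOver K) 𝔭bar (↑(W.sigmaPlacesFinset p K) : Set (HeightOneSpectrum (𝓞 K)))) :=
    fun m => (hDm m).1
  have hrec : ∀ m : ℕ, ∃ Lm : PowerSeries (unrIntegers p ⊗[ℤ_[p]] padicCoeffIntegers (Dm m).ι),
      (XBig.charIdeal κ ((Dm m).Δ.cofreeRepOver K) 𝔭bar
          (↑(W.sigmaPlacesFinset p K) : Set (HeightOneSpectrum (𝓞 K)))).map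
          (PowerSeries.map (Algebra.TensorProduct.includeRight (R := ℤ_[p]) (A := unrIntegers p)
            (B := padicCoeffIntegers (Dm m).ι)).toRingHom) ≤ Ideal.span {Lm} ∧
        Ideal.span {Lm} ≤
          Ideal.span {PowerSeries.map (algebraMap (unrIntegers p)
              (unrIntegers p ⊗[ℤ_[p]] padicCoeffIntegers (Dm m).ι))
              (L * PowerSeries.map (toUnr p) (W.sigmaEulerElement p K κ))} ⊔
            Ideal.span {((p : ℕ) : PowerSeries (unrIntegers p ⊗[ℤ_[p]] padicCoeffIntegers (Dm m).ι)) ^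
              (max m 1)} :=
    fun m => (hDm m).2 _ (algebraMap _ _) _ (toUnr p) (coe_toUnr p)
      (algebraMap_comp_toUnr_eq p (padicCoeffIntegers (Dm m).ι) hj)
  choose Lm hLm using hrec
  -- finite generation of `X^Σ_ac(A_{g_m})` over `Λ_{𝒪_m}`: SU14 Lemma 3.1.9 (the `ℤ_p` fact `hFG`) through defn-ty1's
  -- coefficient reduction (T6) with (T7) `A_g` `p`-primary with finite `p`-torsion and (T8a) unramified outside `Σ ∪ S_p`
  haveI : ∀ m : ℕ, Module.Finite (PowerSeries (padicCoeffIntegers (Dm m).ι))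
      (XBig κ ((Dm m).Δ.cofreeRepOver K) 𝔭bar (↑(W.sigmaPlacesFinset p K) : Set (HeightOneSpectrum (𝓞 K)))) :=
    fun m =>
      haveI := (Dm m).finiteDimensional_padicCoeffField
      SkinnerUrban2014.moduleFinite_XBig_of_lemma319 hFG κ 𝔭bar _ hSfin ((Dm m).Δ.cofreeRepOver K)
        (GreenbergSelmer.Cofree.exists_pow_psmul_eq_zero (Dm m).ι (Dm m).Δ.ρ)
        (GreenbergSelmer.Cofree.divisible (padicCoeffField (Dm m).ι) (Dm m).Δ.ρ (Fact.out : p.Prime).ne_zero)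
        (GreenbergSelmer.Cofree.finite_setOf_psmul_eq_zero (Dm m).ι (Dm m).Δ.ρ)
        (GreenbergSelmer.OrdinaryNewformDatum.cofreeRepOver_localMap_inr_apply_eq_self (Dm m).Δ K _ hSM)
  -- ### the member congruences `e_m`: (F1) + (SelBC) + (Frob) + (b) + Lemma 2.1, at the member of level `max m 1 = m`
  have hEm : ∀ m : ℕ, 1 ≤ m →
      Nonempty ((((PowerSeries (padicCoeffIntegers (Dm m).ι)) ⊗[IwasawaAlgebra p]
            AcSelmer.XAc (W.baseChange K) p κ 𝔭bar (↑(W.sigmaPlacesFinset p K) : Set (HeightOneSpectrum (𝓞 K))) γ) ⧸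
          (((Ideal.span {(C (p : ℤ_[p]) : IwasawaAlgebra p)}).map
              (algebraMap (IwasawaAlgebra p) (PowerSeries (padicCoeffIntegers (Dm m).ι)))) ^ m •
            (⊤ : Submodule (PowerSeries (padicCoeffIntegers (Dm m).ι))
              ((PowerSeries (padicCoeffIntegers (Dm m).ι)) ⊗[IwasawaAlgebra p]
                AcSelmer.XAc (W.baseChange K) p κ 𝔭bar (↑(W.sigmaPlacesFinset p K) : Set (HeightOneSpectrum (𝓞 K))) γ))))
          ≃ₗ[PowerSeries (padicCoeffIntegers (Dm m).ι)]
        (XBig κ ((Dm m).Δ.cofreeRepOver K) 𝔭bar (↑(W.sigmaPlacesFinset p K) : Set (HeightOneSpectrum (𝓞 K))) ⧸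
          (((Ideal.span {(C (p : ℤ_[p]) : IwasawaAlgebra p)}).map
              (algebraMap (IwasawaAlgebra p) (PowerSeries (padicCoeffIntegers (Dm m).ι)))) ^ m •
            (⊤ : Submodule (PowerSeries (padicCoeffIntegers (Dm m).ι))
              (XBig κ ((Dm m).Δ.cofreeRepOver K) 𝔭bar (↑(W.sigmaPlacesFinset p K) : Set (HeightOneSpectrum (𝓞 K)))))))) := by
    intro m hm
    exact nonempty_quotPow_congr_of_eq _ (max_eq_left hm)
      (nonempty_memberCongruence_erratum_of_facts hSh selmerBig_eq_selmerBigDecomp_of_unramifiedOutside_holds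
        Skinner2016.selmerBig_extendScalars_equiv_baseChange_holds hp5 hirr hK.1 hHp 𝔭bar h𝔭bar φ htors _ hSfin
        hSp hS hSM κ hκ γ (Dm m) (le_max_right m 1)).some
  -- ### (c), one-sided, with `(p^m)` in the consumer's spelling
  have hc' : ∀ m : ℕ, 1 ≤ m →
      Ideal.span {Lm m} ≤
        Ideal.span {algebraMap (UnrSeries p) (PowerSeries (unrIntegers p ⊗[ℤ_[p]] padicCoeffIntegers (Dm m).ι))
            (L * PowerSeries.map (toUnr p) (W.sigmaEulerElement p K κ))} ⊔
          (((Ideal.span {(C (p : ℤ_[p]) : IwasawaAlgebra p)}).map (PowerSeries.map (toUnr p))).map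
            (algebraMap (UnrSeries p) (PowerSeries (unrIntegers p ⊗[ℤ_[p]] padicCoeffIntegers (Dm m).ι)))) ^ m :=
    fun m hm => span_le_sup_of_receptacle p (padicCoeffIntegers (Dm m).ι) hm _ (Lm m) (hLm m).2
  -- ### feed the two-slot Fitting congruence frame
  exact P2.RoadFF.fittingCongruenceFrameTwoSlotAt_of_members_descent_le_printed hΩ hL
    (L * PowerSeries.map (toUnr p) (W.sigmaEulerElement p K κ)) (dvd_refl _) hSfin
    (fun m => PowerSeries (padicCoeffIntegers (Dm m).ι))
    (fun m => PowerSeries (unrIntegers p ⊗[ℤ_[p]] padicCoeffIntegers (Dm m).ι))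
    (fun m => PowerSeries.map (Algebra.TensorProduct.includeRight (R := ℤ_[p]) (A := unrIntegers p)
      (B := padicCoeffIntegers (Dm m).ι)).toRingHom)
    (fun m => map_includeRight_comp_algebraMap p (padicCoeffIntegers (Dm m).ι) hj)
    (fun m => XBig κ ((Dm m).Δ.cofreeRepOver K) 𝔭bar (↑(W.sigmaPlacesFinset p K) : Set (HeightOneSpectrum (𝓞 K))))
    Lm (fun m hm => (hEm m hm).some) (fun m _ _ => (hLm m).1) hc'

end Summit.BirchSwinnertonDyer.Rank1Residual.X11b

end
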